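import Summits.ResolutionOfSingularities.ResolutionOfSingularities.Theorems.PinchTowerChart

/-!
# PinchTower (P6/8) — the uniform pinch curve on a regular scheme: PINCH SHAPES AT ITS POINTS (closed points AND `η`)

Node «PinchTower» of `decomp-res-lens-2` (g31), see `Theorems/MaxContactCutPinchTower.lean`.

* `pinchShape_of_isPinchAt` — at a closed point `y` of the curve the letter's frame IS a pinch shape
  `PinchShape 𝓘_y (c₁) n m` whose Σ-pair `(z, u) = (c₀, c₁)` generates the curve prime;
* `pinchShape_eta` — AT THE GENERIC POINT `η`: in `𝒪_η = (𝒪_{y₀})_𝔓` the images of `(c₀, c₁)` are a regular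
  system of parameters, `λvᵏ` becomes a UNIT `μ`, and `zⁿ + uᵐ·μ + g` is a pinch shape with `k = 0` whose exit
  condition holds because over `κ(η) = Frac(𝒪_{y₀}/𝔓)` — a Noetherian local domain with uniformizer `v̄` — the
  class `μ̄ = λ̄ v̄ᵏ` is NOT a cone power (`not_isConePower_frac`: valuation if `0 < k < n`, integral closedness and
  reduction to `κ(y₀)` if `k ∈ {0, n}`; the residue fields of `𝒪_{y₀}` and `𝒪_{y₀}/𝔓` agree, `isConePower_reflect`).
  NO semicontinuity / properness is used: the analysis happens at `η`;
* the curve `cl{η}` is a regular subscheme and lies in the order-`n` locus (`n ≤ m`).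
[cite: Hironaka1964; CossartJannsenSaito2020; CossartPiltant2008; Matsumura1987, Thms. 14.2, 16.2]
-/

open IsLocalRing
open Literature.AlgebraicGeometry.Resolution
open Summit.ResolutionOfSingularities.ResolutionOfSingularities.Theorems.DeltaFaceCutClasses (qWeighted)
open Summit.ResolutionOfSingularities.ResolutionOfSingularities.Theorems.TowerCut
open Summit.ResolutionOfSingularities.ResolutionOfSingularities.Theorems.PinchCut

namespace Summit.ResolutionOfSingularities.ResolutionOfSingularities.Theorems.PinchTower

section SchemeLevel

open CategoryTheory AlgebraicGeometry TopologicalSpace Topology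
open Summit.ResolutionOfSingularities.ResolutionOfSingularities.Theorems
open Summit.ResolutionOfSingularities.ResolutionOfSingularities.Theorems.WeakOrderReduction
open Summit.ResolutionOfSingularities.ResolutionOfSingularities.Theorems.RelativeDeltaCut

variable {Y : Scheme.{0}}

/-! ## §F1  The closed points of the curve -/

/-- **The curve prime at a pinch point is generated by an r.s.o.p. pair, extended by `v` to an r.s.o.p. triple.**
[folklore] -/
theorem isRsopPart_of_isPinchAt [IsLocallyNoetherian Y] (hY : Scheme.IsRegular Y) (I : Y.IdealSheafData)
    {n m : ℕ} {η y : Y} (hpt : IsPinchAt I n m η y) :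
    ∃ (h : η ⤳ y) (c : Fin 2 → Y.presheaf.stalk y) (v : Y.presheaf.stalk y),
      Ideal.span (Set.range c) = curvePrime h ∧ Ideal.span (Set.range c ∪ {v}) = maximalIdeal _ ∧
      @IsRsopPart _ _ (hY y).toIsLocalRing 2 c ∧ @IsRsopPart _ _ (hY y).toIsLocalRing 3 ![c 0, c 1, v] := by
  haveI := hY y
  obtain ⟨h, k, c, v, lam, g, hP, hW', hd, -, -, -, -, -⟩ := hpt
  have hW : Ideal.span (Set.range (Fin.append c ![v])) = maximalIdeal _ := by
    rw [← hW', range_fin_append, Matrix.range_cons, Matrix.range_empty, Set.union_empty]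
  have hc2 : c = ![c 0, c 1] := by funext i; fin_cases i <;> rfl
  refine ⟨h, c, v, hP, hW', ?_, ?_⟩
  · have := isRsopPart_comp_of_rsop hd (Fin.append c ![v]) hW (Fin.castAdd 1) (Fin.castAdd_injective _ _)
    convert this using 1
    funext i
    simp [Fin.append_left]
  · have := isRsopPart_comp_of_rsop hd (Fin.append c ![v]) hW id Function.injective_id
    rwa [Function.comp_id, hc2, vec_append_two_one] at this

/-- **At a pinch point the ideal is `n`-deep along the curve prime** (`n ≤ m`): `𝓘_y ⊆ Q(mn) ⊆ 𝔓ⁿ`, `𝔓 ⊆ 𝔪`.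
[folklore] -/
theorem pinch_stalkIdeal_le (I : Y.IdealSheafData) {n m : ℕ} (hn : 1 ≤ n) (hnm : n ≤ m) {η y : Y}
    (hpt : IsPinchAt I n m η y) :
    ∃ h : η ⤳ y, stalkIdeal I y ≤ curvePrime h ^ n ∧ curvePrime h ≤ maximalIdeal (Y.presheaf.stalk y) := by
  obtain ⟨h, k, c, v, lam, g, hP, hW', -, -, -, -, hJ, -⟩ := hpt
  refine ⟨h, ?_, ?_⟩
  · rw [← hP]
    exact hJ.trans (qWeighted_le_pow c hnm (by omega) (le_of_eq (Nat.mul_comm n m)))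
  · rw [← hP, ← hW']
    exact Ideal.span_mono Set.subset_union_left

/-- **The reduced pinch curve `cl{η}` is a regular scheme.** [folklore] -/
theorem isRegular_pinchCurve_subscheme [IsLocallyNoetherian Y] (hY : Scheme.IsRegular Y)
    (I : Y.IdealSheafData) {n m : ℕ} {η : Y} (hU : IsUniformPinchCurve I n m η) :
    Scheme.IsRegular
      (Scheme.IdealSheafData.vanishingIdeal (⟨closure ({η} : Set Y), isClosed_closure⟩ : Closeds Y)).subscheme := by
  refine isRegular_subscheme_vanishingIdeal_closure_of_forall fun z hz => ?_
  by_cases hzη : z = η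
  · subst hzη
    exact isRegularLocalRing_stalk_quotient_primeOfSpecializes_self z
  · haveI := hY z
    obtain ⟨h, c, v, hP, -, hc, -⟩ := isRsopPart_of_isPinchAt hY I (hU.2 z hz (hU.1.2 z hz hzη))
    change IsRegularLocalRing (Y.presheaf.stalk z ⧸ curvePrime h)
    rw [← hP]
    exact hc.isRegularLocalRing_quotient

/-- **THE PINCH SHAPE AT A CLOSED POINT of the curve**: the letter's frame, with Σ-pair `(c₀, c₁)` generating
the curve prime. [folklore] -/
theorem pinchShape_of_isPinchAt [IsLocallyNoetherian Y] (hY : Scheme.IsRegular Y) (I : Y.IdealSheafData)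
    {n m : ℕ} {η y : Y} (hpt : IsPinchAt I n m η y) :
    ∃ (h : η ⤳ y) (E : Ideal (Y.presheaf.stalk y))
      (D : @PinchShape _ _ (hY y).toIsLocalRing (stalkIdeal I y) E n m),
      Ideal.span (Set.range ![D.z, D.u]) = curvePrime h := by
  haveI := hY y
  obtain ⟨h, k, c, v, lam, g, hP, hW', hd, hlam, hg, hf, hJ, hcond⟩ := hpt
  have hW : Ideal.span (Set.range (Fin.append c ![v])) = maximalIdeal _ := by
    rw [← hW', range_fin_append, Matrix.range_cons, Matrix.range_empty, Set.union_empty]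
  have hc2 : c = ![c 0, c 1] := by funext i; fin_cases i <;> rfl
  have hrs : IsRsopPart c := by
    have := isRsopPart_comp_of_rsop hd (Fin.append c ![v]) hW (Fin.castAdd 1) (Fin.castAdd_injective _ _)
    convert this using 1
    funext i
    simp [Fin.append_left]
  have hrs2 : IsRsopPart ![c 0, c 1] := by rw [← hc2]; exact hrs
  have hrs3 : IsRsopPart ![c 0, c 1, v] := by
    have := isRsopPart_comp_of_rsop hd (Fin.append c ![v]) hW id Function.injective_id
    rwa [Function.comp_id, hc2, vec_append_two_one] at this
  refine ⟨h, Ideal.span {c 1},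
    { z := c 0
      u := c 1
      v := v
      lam := lam
      g := g
      k := k
      rsop := hrs2
      vk := Or.inr hrs3
      unit := hlam
      exc := rfl
      mem := by
        have e : c 0 ^ n + c 1 ^ m * (lam * v ^ k) + g = c 0 ^ n + lam * v ^ k * c 1 ^ m + g := by ring
        rw [e]; exact hf
      tail := by rw [← hc2, Nat.mul_comm]; exact hg
      deep := by rw [← hc2, Nat.mul_comm]; exact hJ
      cond := hcond }, ?_⟩
  change Ideal.span (Set.range ![c 0, c 1]) = curvePrime h
  rw [← hc2, hP]

/-! ## §F2  The generic point `η` of the curve -/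

/-- **THE PINCH SHAPE AT THE GENERIC POINT `η`.**  From the frame at a closed point `y₀ ≠ η`: in
`𝒪_η = (𝒪_{y₀})_𝔓` (`𝔓 = (c₀, c₁)` the curve prime) the images of `c₀, c₁` form a regular system of parameters,
`μ = λvᵏ ∉ 𝔓` is a unit, `c₀ⁿ + c₁ᵐ μ + g ∈ 𝓘_η` with the tail and the depth of the letter, and the exit condition
holds with `k = 0`: if `n ∤ m` trivially, and if `n ∣ m` because `μ̄ ∈ κ(η) = Frac(𝒪_{y₀}/𝔓)` is not a cone power
(`not_isConePower_frac`, fed with the closed-point condition through `isConePower_reflect`). [folklore] -/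
theorem pinchShape_eta [IsLocallyNoetherian Y] (hY : Scheme.IsRegular Y) (C₀ I : Y.IdealSheafData) {n m : ℕ}
    (hn : 1 ≤ n) {η y₀ : Y} (hy₀η : y₀ ≠ η) (hCη : stalkIdeal C₀ η = maximalIdeal (Y.presheaf.stalk η))
    (hpt : IsPinchAt I n m η y₀) :
    ∃ (E : Ideal (Y.presheaf.stalk η)) (D : PinchShape (stalkIdeal I η) E n m),
      Ideal.span (Set.range ![D.z, D.u]) = stalkIdeal C₀ η := by
  classical
  haveI := hY y₀
  obtain ⟨h, k, c, v, lam, g, hP, hW', hd, hlam, hg, hf, hJ, hcond⟩ := hpt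
  have hW : Ideal.span (Set.range (Fin.append c ![v])) = maximalIdeal _ := by
    rw [← hW', range_fin_append, Matrix.range_cons, Matrix.range_empty, Set.union_empty]
  have hrs : IsRsopPart c := by
    have := isRsopPart_comp_of_rsop hd (Fin.append c ![v]) hW (Fin.castAdd 1) (Fin.castAdd_injective _ _)
    convert this using 1
    funext i
    simp [Fin.append_left]
  haveI hPprime : (curvePrime h).IsPrime := by rw [← hP]; exact hrs.isPrime_span_range
  have hPle : curvePrime h ≤ maximalIdeal _ := by
    rw [← hP, ← hW']; exact Ideal.span_mono Set.subset_union_left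
  -- `𝒪_η` is the localisation of `A = 𝒪_{y₀}` at the curve prime `P = (c)`
  letI := (Y.presheaf.stalkSpecializes h).hom.toAlgebra
  haveI hloc : IsLocalization.AtPrime (Y.presheaf.stalk η) (curvePrime h) :=
    isLocalizationAtPrime_stalkSpecializes h
  have halg : algebraMap (Y.presheaf.stalk y₀) (Y.presheaf.stalk η) = (Y.presheaf.stalkSpecializes h).hom :=
    RingHom.algebraMap_toAlgebra _
  have hq : ∀ i, c i ∈ curvePrime h := fun i => by rw [← hP]; exact Ideal.subset_span ⟨i, rfl⟩
  -- `v ∉ P` (else `P = 𝔪_{y₀}` and `η = y₀`) and `λ ∉ P`, so `μ = λ vᵏ` is a unit at `η`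
  have hvP : v ∉ curvePrime h := fun hv => by
    have hle : maximalIdeal (Y.presheaf.stalk y₀) ≤ curvePrime h := by
      rw [← hW', Ideal.span_le]
      rintro x (⟨i, rfl⟩ | hx)
      · exact hq i
      · rw [Set.mem_singleton_iff.mp hx]; exact hv
    have heq : curvePrime h = maximalIdeal _ :=
      ((maximalIdeal.isMaximal _).eq_of_le hPprime.ne_top hle).symm
    have heq' : primeOfSpecializes h = primeOfSpecializes (specializes_refl y₀) := by
      rw [primeOfSpecializes_refl]; exact heq
    exact hy₀η (primeOfSpecializes_injective h (specializes_refl y₀) heq').symm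
  have hlamP : lam ∉ curvePrime h := fun hl => hPprime.ne_top (Ideal.eq_top_of_isUnit_mem _ hl hlam)
  have hlvP : lam * v ^ k ∉ curvePrime h := fun hm =>
    (hPprime.mem_or_mem hm).elim hlamP fun hv => hvP (hPprime.mem_of_pow_mem k hv)
  have hμ : IsUnit (algebraMap (Y.presheaf.stalk y₀) (Y.presheaf.stalk η) (lam * v ^ k)) :=
    IsLocalRing.notMem_maximalIdeal.mp fun hm => hlvP
      ((IsLocalization.AtPrime.to_map_mem_maximal_iff (Y.presheaf.stalk η) (curvePrime h) (lam * v ^ k)).mp hm)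
  -- the frame `c` read in `𝒪_η`
  have hPc : (Ideal.span (Set.range c)).map (algebraMap (Y.presheaf.stalk y₀) (Y.presheaf.stalk η)) =
      Ideal.span (Set.range fun i => algebraMap (Y.presheaf.stalk y₀) (Y.presheaf.stalk η) (c i)) := by
    rw [Ideal.map_span, ← Set.range_comp]; rfl
  have hcm : Ideal.span (Set.range fun i => algebraMap (Y.presheaf.stalk y₀) (Y.presheaf.stalk η) (c i)) =
      maximalIdeal _ := by
    rw [← hPc, hP]; exact IsLocalization.AtPrime.map_eq_maximalIdeal (curvePrime h) (Y.presheaf.stalk η)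
  have hrs' := hrs.map_of_le_prime (curvePrime h) hq (Y.presheaf.stalk η)
  have hc2' : (fun i => algebraMap (Y.presheaf.stalk y₀) (Y.presheaf.stalk η) (c i)) =
      ![algebraMap _ _ (c 0), algebraMap _ _ (c 1)] := by
    funext i; fin_cases i <;> rfl
  have hIη : stalkIdeal I η =
      (stalkIdeal I y₀).map (algebraMap (Y.presheaf.stalk y₀) (Y.presheaf.stalk η)) := by
    rw [halg, stalkIdeal_map_stalkSpecializes]
  -- `D = 𝒪_{y₀}/P`: a Noetherian local domain with maximal ideal `(v̄)`; `𝒪_η/P𝒪_η = Frac D`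
  haveI : IsLocalRing (Y.presheaf.stalk y₀ ⧸ curvePrime h) := isLocalRing_quotient hPle
  haveI hPmax : ((curvePrime h).map (algebraMap (Y.presheaf.stalk y₀) (Y.presheaf.stalk η))).IsMaximal := by
    rw [IsLocalization.AtPrime.map_eq_maximalIdeal (curvePrime h) (Y.presheaf.stalk η)]
    exact maximalIdeal.isMaximal _
  letI : Field (Y.presheaf.stalk η ⧸
      (curvePrime h).map (algebraMap (Y.presheaf.stalk y₀) (Y.presheaf.stalk η))) := Ideal.Quotient.field _
  have hM : Algebra.algebraMapSubmonoid (Y.presheaf.stalk y₀ ⧸ curvePrime h) (curvePrime h).primeCompl =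
      nonZeroDivisors (Y.presheaf.stalk y₀ ⧸ curvePrime h) := by
    ext x
    simp only [Algebra.algebraMapSubmonoid, Submonoid.mem_map, mem_nonZeroDivisors_iff_ne_zero,
      Ideal.Quotient.algebraMap_eq]
    constructor
    · rintro ⟨a, ha, rfl⟩ h0
      exact ha (Ideal.Quotient.eq_zero_iff_mem.mp h0)
    · intro hx
      obtain ⟨a, rfl⟩ := Ideal.Quotient.mk_surjective x
      exact ⟨a, fun ha => hx (Ideal.Quotient.eq_zero_iff_mem.mpr ha), rfl⟩
  haveI : IsFractionRing (Y.presheaf.stalk y₀ ⧸ curvePrime h)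
      (Y.presheaf.stalk η ⧸ (curvePrime h).map (algebraMap (Y.presheaf.stalk y₀) (Y.presheaf.stalk η))) := by
    have hinst : IsLocalization
        (Algebra.algebraMapSubmonoid (Y.presheaf.stalk y₀ ⧸ curvePrime h) (curvePrime h).primeCompl)
        (Y.presheaf.stalk η ⧸ (curvePrime h).map (algebraMap (Y.presheaf.stalk y₀) (Y.presheaf.stalk η))) :=
      inferInstance
    rwa [hM] at hinst
  have hw : maximalIdeal (Y.presheaf.stalk y₀ ⧸ curvePrime h) =
      Ideal.span {Ideal.Quotient.mk (curvePrime h) v} := by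
    have h1 : (maximalIdeal (Y.presheaf.stalk y₀)).map (Ideal.Quotient.mk (curvePrime h)) =
        Ideal.span {Ideal.Quotient.mk (curvePrime h) v} := by
      rw [← hW', Ideal.span_union, Ideal.map_sup, hP, Ideal.map_quotient_self, bot_sup_eq, Ideal.map_span,
        Set.image_singleton]
    rw [← h1, map_mk_maximalIdeal_eq]
  have hw0 : Ideal.Quotient.mk (curvePrime h) v ≠ 0 := fun h0 => hvP (Ideal.Quotient.eq_zero_iff_mem.mp h0)
  -- the residue fields of `𝒪_{y₀}` and `𝒪_{y₀}/P` agree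
  have hlocmk : ∀ x, Ideal.Quotient.mk (curvePrime h) x ∈ maximalIdeal (Y.presheaf.stalk y₀ ⧸ curvePrime h) ↔
      x ∈ maximalIdeal (Y.presheaf.stalk y₀) := fun x => by
    have := mk_mem_pow_maximalIdeal_iff (curvePrime h) x 1
    rwa [pow_one, pow_one, sup_eq_right.mpr hPle] at this
  have hsurjmk : ∀ s : Y.presheaf.stalk y₀ ⧸ curvePrime h, ∃ x, s - Ideal.Quotient.mk (curvePrime h) x ∈
      maximalIdeal (Y.presheaf.stalk y₀ ⧸ curvePrime h) := fun s => by
    obtain ⟨x, rfl⟩ := Ideal.Quotient.mk_surjective s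
    exact ⟨x, by rw [sub_self]; exact Ideal.zero_mem _⟩
  -- the exit condition at `η`
  have hPm : maximalIdeal (Y.presheaf.stalk η) =
      (curvePrime h).map (algebraMap (Y.presheaf.stalk y₀) (Y.presheaf.stalk η)) :=
    (IsLocalization.AtPrime.map_eq_maximalIdeal (curvePrime h) (Y.presheaf.stalk η)).symm
  have hcondη : PinchExitCond (ResidueField (Y.presheaf.stalk η)) n 0 m
      (residue _ (algebraMap (Y.presheaf.stalk y₀) (Y.presheaf.stalk η) (lam * v ^ k))) := by
    by_cases hmn : 0 < m % n
    · exact Or.inl ⟨hmn, by have := Nat.mod_lt m (show n > 0 by omega); omega⟩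
    · have hm0 : m % n = 0 := by omega
      refine Or.inr (Or.inr ⟨hm0, Or.inl rfl, fun hcone => ?_⟩)
      have hc' : (0 < k ∧ k < n) ∨ ((k = 0 ∨ k = n) ∧
          ¬ IsConePower (ResidueField (Y.presheaf.stalk y₀ ⧸ curvePrime h)) n
            (residue _ (Ideal.Quotient.mk (curvePrime h) lam))) := by
        rcases hcond with ⟨h1, -⟩ | ⟨-, h2, h3⟩ | ⟨-, h2, h3⟩
        · omega
        · exact Or.inl ⟨h2, h3⟩
        · exact Or.inr ⟨h2, fun hc =>
            h3 (isConePower_reflect (Ideal.Quotient.mk (curvePrime h)) hlocmk hsurjmk hc)⟩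
      have h2 := isConePower_map (Ideal.quotEquivOfEq hPm).toRingHom hcone
      have he : (Ideal.quotEquivOfEq hPm).toRingHom
          (residue _ (algebraMap (Y.presheaf.stalk y₀) (Y.presheaf.stalk η) (lam * v ^ k))) =
          Ideal.Quotient.mk _ (algebraMap (Y.presheaf.stalk y₀) (Y.presheaf.stalk η) (lam * v ^ k)) :=
        Ideal.quotEquivOfEq_mk _ _
      rw [he] at h2
      refine not_isConePower_frac
        (K := Y.presheaf.stalk η ⧸ (curvePrime h).map (algebraMap (Y.presheaf.stalk y₀) (Y.presheaf.stalk η)))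
        hw hw0 (hlam.map (Ideal.Quotient.mk (curvePrime h))) hn hc' ?_
      rw [← map_pow, ← map_mul, Ideal.Quotient.algebraMap_quotient_map_quotient]
      exact h2
  refine ⟨Ideal.span {algebraMap _ _ (c 1)},
    { z := algebraMap _ _ (c 0)
      u := algebraMap _ _ (c 1)
      v := 0
      lam := algebraMap _ _ (lam * v ^ k)
      g := algebraMap _ _ g
      k := 0
      rsop := by rw [← hc2']; exact hrs'
      vk := Or.inl rfl
      unit := hμ
      exc := rfl
      mem := by
        have e : algebraMap _ _ (c 0) ^ n + algebraMap _ _ (c 1) ^ m *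
            (algebraMap (Y.presheaf.stalk y₀) (Y.presheaf.stalk η) (lam * v ^ k) * (0 : Y.presheaf.stalk η) ^ 0) +
            algebraMap _ _ g =
            algebraMap (Y.presheaf.stalk y₀) (Y.presheaf.stalk η) (c 0 ^ n + lam * v ^ k * c 1 ^ m + g) := by
          simp only [map_add, map_mul, map_pow, pow_zero, mul_one]
          ring
        rw [e, hIη]
        exact Ideal.mem_map_of_mem _ hf
      tail := by
        have := Ideal.mem_map_of_mem (algebraMap (Y.presheaf.stalk y₀) (Y.presheaf.stalk η)) hg
        rwa [map_qWeighted, hc2', Nat.mul_comm] at this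
      deep := by
        rw [hIη]
        refine (Ideal.map_mono hJ).trans ?_
        rw [map_qWeighted, hc2', Nat.mul_comm]
      cond := hcondη }, ?_⟩
  change Ideal.span (Set.range ![algebraMap _ _ (c 0), algebraMap _ _ (c 1)]) = stalkIdeal C₀ η
  rw [← hc2', hcm, hCη]

end SchemeLevel

end Summit.ResolutionOfSingularities.ResolutionOfSingularities.Theorems.PinchTower
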